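import Literature.MathematicalPhysics.QuantumLattice.LatticeScalarField

/-!
# Bumps interpolating lattice weights (route-independent support for `SqueezedSkewness.HighBallFloorsLPGlue`,
# stmt-QuantumFields-22797)

Elementary facts used to realise the route's lattice site-weights (`ind`, `kap`) as values `f(s·posE x)` of Schwartz
functions: (1) distinct points of `s·ℤ⁴` are `≥ s` apart, so a `ContDiffBump` of outer radius `≤ s/2` centred at
`s·u`, `u ∈ ℤ⁴`, takes the value `1[u = v]` at `s·v`; (2) the centred coordinate `cc n i = if 2i < n then i else i − n` of
the route is injective on `Fin n`, is `≡ i (mod n)`, and equals `m ≥ 0` iff `i = m` (when `2m < n`); (3) the lattice sum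
(`tsum` over `ℤ⁴`) of such a bump against any weight is the single term at its centre.  No definitions. [folklore]
-/

noncomputable section

open scoped BigOperators
open MeasureTheory Filter Topology Set Metric Finset
open Literature.MathematicalPhysics.QuantumLattice

namespace Summit.QuantumFields.YangMills.Theorems.SqueezedSkewnessLatticeBumps

/-! ## §1 The centred coordinate -/

/-- `cc n i ≡ i (mod n)`. [folklore] -/
theorem cc_emod (n : ℕ) (i : Fin n) :
    ∃ k : ℤ, (if 2 * i.val < n then (i.val : ℤ) else (i.val : ℤ) - n) = (i.val : ℤ) + k * n := by
  by_cases h : 2 * i.val < n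
  · exact ⟨0, by simp [h]⟩
  · exact ⟨-1, by simp [h]; ring⟩

/-- `cc n` is injective. [folklore] -/
theorem cc_injective (n : ℕ) {i j : Fin n}
    (h : (if 2 * i.val < n then (i.val : ℤ) else (i.val : ℤ) - n) = (if 2 * j.val < n then (j.val : ℤ) else (j.val : ℤ) - n)) :
    i = j := by
  apply Fin.ext
  have hi := i.isLt
  have hj := j.isLt
  by_cases h1 : 2 * i.val < n <;> by_cases h2 : 2 * j.val < n <;> simp only [h1, h2, if_true, if_false] at h <;> omega

/-- For `0 ≤ m` with `2m < n`: `cc n i = m ↔ i = m`. [folklore] -/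
theorem cc_eq_iff (n : ℕ) (i : Fin n) (m : ℕ) (hm : 2 * m < n) :
    (if 2 * i.val < n then (i.val : ℤ) else (i.val : ℤ) - n) = (m : ℤ) ↔ i.val = m := by
  have hi := i.isLt
  by_cases h1 : 2 * i.val < n <;> simp only [h1, if_true, if_false] <;> omega

/-- `|cc n i| ≤ n/2`, in the form `2|cc n i| ≤ n`. [folklore] -/
theorem two_mul_abs_cc_le (n : ℕ) (i : Fin n) :
    2 * |(if 2 * i.val < n then (i.val : ℤ) else (i.val : ℤ) - n)| ≤ n := by
  have hi := i.isLt
  by_cases h1 : 2 * i.val < n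
  · simp only [h1, if_true]; rw [abs_of_nonneg (by positivity)]; omega
  · simp only [h1, if_false]; rw [abs_of_nonpos (by omega)]; omega

/-! ## §2 Bumps on the scaled lattice -/

/-- Distinct points of `s·ℤ⁴` are at distance `≥ s`. [folklore] -/
theorem dist_smul_siteToE_ge {s : ℝ} (hs : 0 < s) {u v : Fin 4 → ℤ} (huv : u ≠ v) :
    s ≤ dist (s • siteToE (d := 4) u) (s • siteToE (d := 4) v) := by
  obtain ⟨i, hi⟩ : ∃ i, u i ≠ v i := by
    by_contra h
    push Not at h
    exact huv (funext h)
  have h1 : dist ((s • siteToE (d := 4) u) i) ((s • siteToE (d := 4) v) i) ≤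
      dist (s • siteToE (d := 4) u) (s • siteToE (d := 4) v) := PiLp.dist_apply_le _ _ i
  have h2 : (s • siteToE (d := 4) u) i = s * (u i : ℝ) := by simp [siteToE_apply]
  have h3 : (s • siteToE (d := 4) v) i = s * (v i : ℝ) := by simp [siteToE_apply]
  rw [h2, h3, Real.dist_eq, ← mul_sub, abs_mul, abs_of_pos hs] at h1
  have h4 : (1 : ℝ) ≤ |(u i : ℝ) - (v i : ℝ)| := by
    have : (1 : ℤ) ≤ |u i - v i| := Int.one_le_abs (sub_ne_zero.mpr hi)
    have h' : ((1 : ℤ) : ℝ) ≤ ((|u i - v i| : ℤ) : ℝ) := by exact_mod_cast this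
    simpa [Int.cast_abs, Int.cast_sub] using h'
  nlinarith

/-- A bump of outer radius `≤ s/2` centred at `s·u` reads `1[u = v]` at `s·v`. [folklore] -/
theorem bump_smul_siteToE {s : ℝ} (hs : 0 < s) (u v : Fin 4 → ℤ) (φ : ContDiffBump (s • siteToE (d := 4) u))
    (hφ : φ.rOut ≤ s / 2) : (φ : EuclideanSpace ℝ (Fin 4) → ℝ) (s • siteToE (d := 4) v) = if u = v then 1 else 0 := by
  by_cases huv : u = v
  · subst huv
    rw [if_pos rfl]
    exact φ.one_of_mem_closedBall (Metric.mem_closedBall_self φ.rIn_pos.le)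
  · rw [if_neg huv]
    apply φ.zero_of_le_dist
    rw [dist_comm]
    exact hφ.trans ((by linarith : s / 2 ≤ s)) |>.trans (dist_smul_siteToE_ge hs huv)

/-- The lattice sum of (bump × weight) is the single term at the centre. [folklore] -/
theorem tsum_bump_mul {s : ℝ} (hs : 0 < s) (u : Fin 4 → ℤ) (φ : ContDiffBump (s • siteToE (d := 4) u))
    (hφ : φ.rOut ≤ s / 2) (g : (Fin 4 → ℤ) → ℂ) :
    ∑' v : Fin 4 → ℤ, ((φ : EuclideanSpace ℝ (Fin 4) → ℝ) (s • siteToE (d := 4) v) : ℂ) * g v = g u := by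
  rw [tsum_eq_single u]
  · rw [bump_smul_siteToE hs u u φ hφ, if_pos rfl]; simp
  · intro v hv
    rw [bump_smul_siteToE hs u v φ hφ, if_neg (Ne.symm hv)]; simp

/-- Supports: the bump's topological support sits in the closed ball of radius `rOut` around its centre, whose points
have every coordinate within `rOut` of the centre's. [folklore] -/
theorem coord_le_of_mem_tsupport {c : EuclideanSpace ℝ (Fin 4)} (φ : ContDiffBump c) {y : EuclideanSpace ℝ (Fin 4)}
    (hy : y ∈ tsupport (φ : EuclideanSpace ℝ (Fin 4) → ℝ)) (i : Fin 4) : |y i - c i| ≤ φ.rOut := by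
  rw [φ.tsupport_eq, Metric.mem_closedBall] at hy
  have h := PiLp.dist_apply_le y c i
  rw [Real.dist_eq] at h
  exact h.trans hy

end Summit.QuantumFields.YangMills.Theorems.SqueezedSkewnessLatticeBumps

end
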